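import Summits.BirchSwinnertonDyer.Rank1Residual.ManinAdditive.TwistOrbitIndexEngine
import Summits.BirchSwinnertonDyer.Rank1Residual.ManinAdditive.CommutingOrbitManinValEq
import HarnessLib
import HarnessLib.Audit.Tags

/-!
# §24 (instances) THE INDEX ENGINE AT `d = q*`, `q` odd, `q² ∣ N`; E-imc-4 (i) PROVED at odd `p`
# (E-an-27 `RamifiedTwistDegreeDichotomyOdd` + `_holds`); E-imc-2 ⇒ E-imc-7R at odd `p` (E-an-28 edge
# `RamifiedTwistDegreeTrichotomyOfManinInvariance` + `_holds`) — cell `bsd-f2-manin`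

Cell `bsd-f2-manin` (D-0131 (3) frontier: the Manin constant at additive primes), analytic lens
(planner `bsd-f2-manin-an` g5), typed VERBATIM by the cell typer from HOME `run/shared/lean/pub/bsd-f2-manin/an/Sec24Core-g5.lean` sha16 9ed34f9b51be5933 (1181 lines, §24–§26 of the cumulative HOME `an/Sketch-an6.lean` bd37945ff22921ca over TREE imports only; farm rc 0 · 0 errors · 0 warnings · 0 sorries; MEMO-an §41–§43; CANDIDATES rows E-an-26…31), split into four chained theorem
files `TwistOrbitIndexEngine` (§24 core) ← `TwistOrbitIndexEngineOdd` (§24 instances at `d = q*` and the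
edge E-imc-2 ⇒ E-imc-7R) ← `TwistOrbitIsogenyDegree` (§25) ← `RamifiedTwistOptimalityCommutesProof` (§26,
the closer of imc's landed leaf E-imc-3b), plus the conjecture-only leaf `CommutingOrbitManinValEq.lean`
(E-an-28's open target). Nothing conjectural is asserted: every open law enters as an explicit hypothesis;
the `@[conjecture]` obligations declared in these files come with their kernel-checked `_holds`.

THIS FILE (source lines 382–726, the open target `CommutingOrbitManinValEq` moved to its own leaf): the
two-sided Stevens steps at `(q*, q²)` from the tree's `Γ₁`-route feed the §24 engine; consequences: the full
orbit trichotomy at `d = p*`, imc's landed leaf E-imc-4 (i) `RamifiedTwistDegreeDichotomy p d` PROVED for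
every odd prime `p` (hypothesis-free packaging `RamifiedTwistDegreeDichotomyOdd p d` with `_holds`), and the
PROVED edge «E-imc-2 `RamifiedTwistManinInvariance p` ⇒ E-imc-7R `RamifiedTwistDegreeTrichotomy p d`» at
odd `p` through `CommutingOrbitManinValEq p` (packaged as `RamifiedTwistDegreeTrichotomyOfManinInvariance`
with `_holds`).
-/

noncomputable section

open scoped MatrixGroups ModularForm

open CongruenceSubgroup WeierstrassCurve
  Literature.NumberTheory.DiophantineGeometry
  Literature.NumberTheory.EllipticCurves
  Literature.NumberTheory.EllipticCurves.ModularForms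

namespace Summit.BirchSwinnertonDyer.Rank1Residual.ManinAdditive

section CovolumeEngine

open scoped Pointwise

/-! ### Instances at `d = q*`, `q` odd, `q² ∣ N` (two-sided Stevens steps from the tree's Γ₁-route) -/

/-- The orbit data at `(q*, q²)`: two-sided Gauss-sum steps and `|aₙ(f′)| = |aₙ(f)|` from `W ⊗ q* ~ W′`,
`q² ∣ N = N′` (verbatim the data block of §23's `pStar_optimal_commuting_degree_jump`, with the isogeny's
`LFunction_eq` in place of the isomorphism). [cite: Stevens1989, (5.4)–(5.5) p. 97] -/
theorem pStar_orbit_steps {q : ℕ} [Fact q.Prime] (hq2 : q ≠ 2) {W W' : WeierstrassCurve ℚ}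
    [W.IsElliptic] [W'.IsElliptic] [NeZero (W.conductorNorm ℤ)] [NeZero (W'.conductorNorm ℤ)]
    (D : ModularParametrizationData W (W.conductorNorm ℤ))
    (D' : ModularParametrizationData W' (W'.conductorNorm ℤ)) (hM : q ^ 2 ∣ W.conductorNorm ℤ)
    (hN : W'.conductorNorm ℤ = W.conductorNorm ℤ)
    (hiso : IsIsogenous (W.quadraticTwist ((((-1 : ℤ) ^ (q / 2) * q : ℤ)) : ℚ)) W') :
    (∀ w ∈ periodLattice D'.f, gaussSum ((quadraticChar (ZMod q)).ringHomComp (Int.castRingHom ℂ))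
        (ZMod.stdAddChar (N := q)) * w ∈ periodLattice D.f) ∧
    (∀ w ∈ periodLattice D.f, gaussSum ((quadraticChar (ZMod q)).ringHomComp (Int.castRingHom ℂ))
        (ZMod.stdAddChar (N := q)) * w ∈ periodLattice D'.f) ∧
    (∀ n : ℕ, ‖cuspCoeff D'.f n‖ = ‖cuspCoeff D.f n‖) := by
  have hq : q.Prime := Fact.out
  set d : ℤ := (-1 : ℤ) ^ (q / 2) * q with hd
  have hdZ : d ≠ 0 := mul_ne_zero (pow_ne_zero _ (by norm_num)) (by exact_mod_cast hq.ne_zero)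
  have hd0 : (d : ℚ) ≠ 0 := by exact_mod_cast hdZ
  haveI := W.isElliptic_quadraticTwist hd0
  have hu : (1 : VariableChange ℚ) • W.quadraticTwist (d : ℚ) = W.quadraticTwist (d : ℚ) := one_smul _ _
  have hM' : q ^ 2 ∣ W'.conductorNorm ℤ := by rw [hN]; exact hM
  obtain ⟨hngW, hnmW⟩ := not_good_and_not_mult_of_sq_dvd_conductorNorm W hM
  obtain ⟨hngW', hnmW'⟩ := not_good_and_not_mult_of_sq_dvd_conductorNorm W' hM'
  have hW0 : ∀ n : ℕ, q ∣ n → W.LFunction n = 0 := fun n hn ↦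
    W.LFunction_apply_eq_zero_of_not_good_of_not_mult q hngW hnmW hn
  have hW'0 : ∀ n : ℕ, q ∣ n → W'.LFunction n = 0 := fun n hn ↦
    W'.LFunction_apply_eq_zero_of_not_good_of_not_mult q hngW' hnmW' hn
  have hT0 : ∀ n : ℕ, q ∣ n → (W.quadraticTwist (d : ℚ)).LFunction n = 0 := fun n hn ↦ by
    rw [hiso.LFunction_eq]; exact hW'0 n hn
  have hcoef := fun n ↦ cuspCoeff_eq_chi_mul_of_twist_pStar hq2 1 hu hiso.LFunction_eq hW'0 D D' n
  have hcoef' := fun n ↦ cuspCoeff_eq_chi_mul_of_twist_pStar' hq2 1 hu hiso.LFunction_eq hW0 D D' n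
  have hχq := isQuadratic_quadraticChar_ringHomComp q
  have hχp := isPrimitive_quadraticChar_ringHomComp q hq2
  have hNdvd : W.conductorNorm ℤ ∣ W'.conductorNorm ℤ := by rw [hN]
  have hNdvd' : W'.conductorNorm ℤ ∣ W.conductorNorm ℤ := by rw [hN]
  have htw' : charTwist (W'.conductorNorm ℤ) hNdvd hM' hχq D.f = D'.f :=
    eq_of_forall_cuspCoeff_eq_gamma0 fun n ↦ by rw [cuspCoeff_charTwist _ hNdvd hM' hχq hχp, hcoef n]
  have htw : charTwist (W.conductorNorm ℤ) hNdvd' hM hχq D'.f = D.f :=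
    eq_of_forall_cuspCoeff_eq_gamma0 fun n ↦ by rw [cuspCoeff_charTwist _ hNdvd' hM hχq hχp, hcoef' n]
  refine ⟨fun w hw ↦ ?_, fun w hw ↦ ?_, fun n ↦ ?_⟩
  · rw [← htw'] at hw
    exact gaussSum_mul_mem_periodLattice_of_mem_charTwist _ hNdvd hM' hχq hχp D.f hw
  · rw [← htw] at hw
    exact gaussSum_mul_mem_periodLattice_of_mem_charTwist _ hNdvd' hM hχq hχp D'.f hw
  · rw [D'.isNewformOf.2 n, D.isNewformOf.2 n, Complex.norm_intCast, Complex.norm_intCast,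
      ← hiso.LFunction_eq]
    have key := congrArg (fun m : ℕ ↦ (m : ℝ))
      (W.natAbs_LFunction_quadraticTwist_pStar_eq_of_apply_eq_zero hq2 hW0 hT0 n)
    simp only [Nat.cast_natAbs, Int.cast_abs] at key
    exact key

/-- **THE OPTIMAL-ORBIT TRICHOTOMY at `(q*, q²)`, `q` odd, WITH ITS MANIN–DISCRIMINANT IDENTITIES
(E-imc-4 (i) / 7R modulus, PROVED; the 7R COUPLING in «Manin-twisted» form):** on a same-level
`χ_{q*}`-orbit of lattice-optimal data with `q² ∣ N`, EITHER `W ⊗ q* ≅ W′` over `ℚ` with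
`deg′ = q·deg` and `c′¹²Δ(W′) = c¹²(q*)⁶Δ(W)`, OR `W ⊗ q* ≅ W′` with `q·deg′ = deg` and
`c′¹²(q*)⁶Δ(W′) = c¹²Δ(W)`, OR `deg φ′ = deg φ` — no irreducibility, CM allowed, no isomorphism assumed,
no minimality assumed. -/
theorem pStar_optimal_orbit_trichotomy_full {q : ℕ} (hq : q.Prime) (hq2 : q ≠ 2) :
    ∀ (W W' : WeierstrassCurve ℚ) [W.IsElliptic] [W'.IsElliptic] [NeZero (W.conductorNorm ℤ)]
      [NeZero (W'.conductorNorm ℤ)] (D : ModularParametrizationData W (W.conductorNorm ℤ))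
      (D' : ModularParametrizationData W' (W'.conductorNorm ℤ)),
      IsLatticeOptimal D → IsLatticeOptimal D' →
      q ^ 2 ∣ W.conductorNorm ℤ → W'.conductorNorm ℤ = W.conductorNorm ℤ →
      IsIsogenous (W.quadraticTwist ((((-1 : ℤ) ^ (q / 2) * q : ℤ)) : ℚ)) W' →
      ((∃ u : VariableChange ℚ, u • W.quadraticTwist ((((-1 : ℤ) ^ (q / 2) * q : ℤ)) : ℚ) = W') ∧
          D'.modularDegree = q * D.modularDegree ∧
          (D'.c : ℚ) ^ 12 * W'.Δ = (D.c : ℚ) ^ 12 * (((((-1 : ℤ) ^ (q / 2) * q : ℤ)) : ℚ) ^ 6 * W.Δ)) ∨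
      ((∃ u : VariableChange ℚ, u • W.quadraticTwist ((((-1 : ℤ) ^ (q / 2) * q : ℤ)) : ℚ) = W') ∧
          q * D'.modularDegree = D.modularDegree ∧
          (D'.c : ℚ) ^ 12 * (((((-1 : ℤ) ^ (q / 2) * q : ℤ)) : ℚ) ^ 6 * W'.Δ) = (D.c : ℚ) ^ 12 * W.Δ) ∨
        D'.modularDegree = D.modularDegree := by
  intro W W' _ _ _ _ D D' hD hD' hM hN hiso
  haveI : Fact q.Prime := ⟨hq⟩
  set d : ℤ := (-1 : ℤ) ^ (q / 2) * q with hd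
  have hdZ : d ≠ 0 := mul_ne_zero (pow_ne_zero _ (by norm_num)) (by exact_mod_cast hq.ne_zero)
  have hd0 : (d : ℚ) ≠ 0 := by exact_mod_cast hdZ
  set G : ℂ := gaussSum ((quadraticChar (ZMod q)).ringHomComp (Int.castRingHom ℂ))
    (ZMod.stdAddChar (N := q)) with hGdef
  have hG2 : G ^ 2 = ((d : ℚ) : ℂ) := by
    rw [hGdef, gaussSum_quadraticChar_ringHomComp_sq q hq2, hd]
    push_cast
    ring
  have hG0 : G ≠ 0 := by
    intro h0
    have : ((d : ℚ) : ℂ) = 0 := by rw [← hG2, h0]; simp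
    exact hd0 (by exact_mod_cast this)
  have ha : ‖G‖ ^ 2 = q := by
    rw [← norm_pow, hG2, hd]
    push_cast
    rw [norm_mul, norm_pow, norm_neg, norm_one, one_pow, one_mul, Complex.norm_natCast]
  obtain ⟨h1, h2, hcoef⟩ := pStar_orbit_steps hq2 D D' hM hN hiso
  rcases optimal_orbit_trichotomy_full hN D D' hD hD' hd0 hG0 hG2 hq ha h1 h2 hcoef with
    h | h | ⟨h, -, -⟩
  · exact Or.inl h
  · exact Or.inr (Or.inl h)
  · exact Or.inr (Or.inr h)

/-- **THE OPTIMAL-ORBIT DEGREE TRICHOTOMY at `(q*, q²)`, `q` odd (E-imc-4 (i) / 7R modulus, PROVED):**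
on a same-level `χ_{q*}`-orbit of lattice-optimal data with `q² ∣ N`, EITHER `W ⊗ q* ≅ W′` over `ℚ` and
`deg′ ∈ {q·deg, deg/q}`, OR `deg φ′ = deg φ` — no irreducibility, CM allowed, no isomorphism assumed. -/
theorem pStar_optimal_orbit_trichotomy {q : ℕ} (hq : q.Prime) (hq2 : q ≠ 2) :
    ∀ (W W' : WeierstrassCurve ℚ) [W.IsElliptic] [W'.IsElliptic] [NeZero (W.conductorNorm ℤ)]
      [NeZero (W'.conductorNorm ℤ)] (D : ModularParametrizationData W (W.conductorNorm ℤ))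
      (D' : ModularParametrizationData W' (W'.conductorNorm ℤ)),
      IsLatticeOptimal D → IsLatticeOptimal D' →
      q ^ 2 ∣ W.conductorNorm ℤ → W'.conductorNorm ℤ = W.conductorNorm ℤ →
      IsIsogenous (W.quadraticTwist ((((-1 : ℤ) ^ (q / 2) * q : ℤ)) : ℚ)) W' →
      ((∃ u : VariableChange ℚ, u • W.quadraticTwist ((((-1 : ℤ) ^ (q / 2) * q : ℤ)) : ℚ) = W') ∧
          (D'.modularDegree = q * D.modularDegree ∨ q * D'.modularDegree = D.modularDegree)) ∨
        D'.modularDegree = D.modularDegree := by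
  intro W W' _ _ _ _ D D' hD hD' hM hN hiso
  rcases pStar_optimal_orbit_trichotomy_full hq hq2 W W' D D' hD hD' hM hN hiso with
    ⟨hu, hdeg, -⟩ | ⟨hu, hdeg, -⟩ | hdeg
  · exact Or.inl ⟨hu, Or.inl hdeg⟩
  · exact Or.inl ⟨hu, Or.inr hdeg⟩
  · exact Or.inr hdeg

/-- **FLIP ⇒ EQUAL DEGREE at `(q*, q²)`, `q` odd (imc's E-imc-9b converse, PROVED):** two lattice-optimal
data on a same-level `χ_{q*}`-orbit whose curves are NOT twists of each other's models have
`deg φ′ = deg φ`. -/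
theorem pStar_optimal_flip_modularDegree_eq {q : ℕ} (hq : q.Prime) (hq2 : q ≠ 2)
    {W W' : WeierstrassCurve ℚ} [W.IsElliptic] [W'.IsElliptic] [NeZero (W.conductorNorm ℤ)]
    [NeZero (W'.conductorNorm ℤ)] (D : ModularParametrizationData W (W.conductorNorm ℤ))
    (D' : ModularParametrizationData W' (W'.conductorNorm ℤ)) (hD : IsLatticeOptimal D)
    (hD' : IsLatticeOptimal D') (hM : q ^ 2 ∣ W.conductorNorm ℤ)
    (hN : W'.conductorNorm ℤ = W.conductorNorm ℤ)
    (hiso : IsIsogenous (W.quadraticTwist ((((-1 : ℤ) ^ (q / 2) * q : ℤ)) : ℚ)) W')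
    (hflip : ∀ u : VariableChange ℚ, u • W.quadraticTwist ((((-1 : ℤ) ^ (q / 2) * q : ℤ)) : ℚ) ≠ W') :
    D'.modularDegree = D.modularDegree := by
  rcases pStar_optimal_orbit_trichotomy hq hq2 W W' D D' hD hD' hM hN hiso with ⟨⟨u, hu⟩, _⟩ | h
  · exact absurd hu (hflip u)
  · exact h

/-- **E-imc-4 (i) `RamifiedTwistDegreeDichotomy p p*` at every ODD prime is a THEOREM:**
`|v_p(deg φ′) − v_p(deg φ)| ≤ 1` on same-conductor ramified twist pairs of lattice-optimal data. -/
theorem ramifiedTwistDegreeDichotomy_of_odd {p : ℕ} (hp2 : p ≠ 2) (d : ℤ) :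
    RamifiedTwistDegreeDichotomy p d := by
  intro W W' _ _ _ _ _ _ D D' hp hd hD hD' hM hN hiso
  haveI : Fact p.Prime := ⟨hp⟩
  rcases hd with hd | ⟨rfl, _⟩
  · rw [hd] at hiso
    have hpos : 0 < D.modularDegree := D.deg_pos
    have hpos' : 0 < D'.modularDegree := D'.deg_pos
    rcases pStar_optimal_orbit_trichotomy hp hp2 W W' D D' hD hD' hM hN hiso with
      ⟨_, h | h⟩ | h
    · have hv : padicValNat p D'.modularDegree = padicValNat p D.modularDegree + 1 := by
        rw [h, padicValNat.mul hp.ne_zero hpos.ne', padicValNat_self]; ring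
      constructor <;> omega
    · have hv : padicValNat p D.modularDegree = padicValNat p D'.modularDegree + 1 := by
        rw [← h, padicValNat.mul hp.ne_zero hpos'.ne', padicValNat_self]; ring
      constructor <;> omega
    · rw [h]
      constructor <;> omega
  · exact absurd rfl hp2

/-- `RamifiedTwistDegreeDichotomy 3 d` (credit-bearing instance of the odd-`p` theorem). -/
theorem ramifiedTwistDegreeDichotomy_three (d : ℤ) : RamifiedTwistDegreeDichotomy 3 d :=
  ramifiedTwistDegreeDichotomy_of_odd (by norm_num) d

/-- `RamifiedTwistDegreeDichotomy 5 d`. -/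
theorem ramifiedTwistDegreeDichotomy_five (d : ℤ) : RamifiedTwistDegreeDichotomy 5 d :=
  ramifiedTwistDegreeDichotomy_of_odd (by norm_num) d

/-- `RamifiedTwistDegreeDichotomy 7 d`. -/
theorem ramifiedTwistDegreeDichotomy_seven (d : ℤ) : RamifiedTwistDegreeDichotomy 7 d :=
  ramifiedTwistDegreeDichotomy_of_odd (by norm_num) d

/-- **Hypothesis-free packaging of the odd-`p` theorem** (so the audit sees a closed statement item):
`RamifiedTwistDegreeDichotomyOdd p d := p ≠ 2 → RamifiedTwistDegreeDichotomy p d`.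
[cite: Watkins2002, §2.1 p. 491 (shape)] -/
@[conjecture] def RamifiedTwistDegreeDichotomyOdd (p : ℕ) (d : ℤ) : Prop :=
  p ≠ 2 → RamifiedTwistDegreeDichotomy p d

/-- `ramifiedTwistDegreeDichotomyOdd_holds`: the kernel-checked closer (hypothesis-free). -/
theorem ramifiedTwistDegreeDichotomyOdd_holds (p : ℕ) (d : ℤ) : RamifiedTwistDegreeDichotomyOdd p d :=
  fun hp2 ↦ ramifiedTwistDegreeDichotomy_of_odd hp2 d

/-! ### E-imc-7R ⟸ E-imc-1b at odd `p` (the coupling is orbit Manin `p`-invariance on COMMUTING pairs) -/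

/-- `v_p(cⁿ) = n·v_p(c)`. -/
theorem padicValInt_pow' {p : ℕ} [Fact p.Prime] (c : ℤ) (n : ℕ) :
    padicValInt p (c ^ n) = n * padicValInt p c := by
  rw [padicValInt, padicValInt, Int.natAbs_pow, padicValNat.pow]

/-- `v_p(p*) = 1`. -/
theorem padicValInt_pStar {p : ℕ} [Fact p.Prime] : padicValInt p ((-1 : ℤ) ^ (p / 2) * p) = 1 := by
  have hp : p.Prime := Fact.out
  rw [padicValInt.mul (pow_ne_zero _ (by norm_num)) (by exact_mod_cast hp.ne_zero), padicValInt_self,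
    padicValInt_pow']
  simp [padicValInt]

/-- **THE MANIN SHIFT MEASURED BY DEGREES AND DISCRIMINANTS (valuation form of the trichotomy, `p` odd,
globally minimal models, no Manin input):** on a same-level lattice-optimal `χ_{p*}`-orbit,
`(deg′ = p·deg ∧ 12·v_p(c′) + v_pΔ′ = 12·v_p(c) + 6 + v_pΔ) ∨ (p·deg′ = deg ∧ 12·v_p(c′) + 6 + v_pΔ′ =
12·v_p(c) + v_pΔ) ∨ deg′ = deg` — so on every degree-jumping (commuting) orbit the census columns
(direction of the jump, `v_pΔ′ − v_pΔ`) DETERMINE `v_p(c′) − v_p(c) = (±6 − (v_pΔ′ − v_pΔ))/12`; E-imc-1b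
(`v_p(c′) = v_p(c)`) ⟺ the DIRECTION LAW «the member of larger degree is the one with `v_pΔ` larger by 6»
(census N < 5·10⁵: 667 706 / 667 706 odd-`p` commuting rows have `(Δdeg, v_pΔ′ − v_pΔ) ∈ {(1, 6), (−1, −6)}`). -/
theorem pStar_optimal_orbit_trichotomy_val {p : ℕ} (hp : p.Prime) (hp2 : p ≠ 2) :
    ∀ (W W' : WeierstrassCurve ℚ) [W.IsElliptic] [W.IsGloballyMinimal] [W'.IsElliptic]
      [W'.IsGloballyMinimal] [NeZero (W.conductorNorm ℤ)] [NeZero (W'.conductorNorm ℤ)]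
      (D : ModularParametrizationData W (W.conductorNorm ℤ))
      (D' : ModularParametrizationData W' (W'.conductorNorm ℤ)),
      IsLatticeOptimal D → IsLatticeOptimal D' →
      p ^ 2 ∣ W.conductorNorm ℤ → W'.conductorNorm ℤ = W.conductorNorm ℤ →
      IsIsogenous (W.quadraticTwist ((((-1 : ℤ) ^ (p / 2) * p : ℤ)) : ℚ)) W' →
      (D'.modularDegree = p * D.modularDegree ∧
          12 * padicValInt p D'.c + padicValInt p W'.minimalDiscriminantInt =
            12 * padicValInt p D.c + 6 + padicValInt p W.minimalDiscriminantInt) ∨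
      (p * D'.modularDegree = D.modularDegree ∧
          12 * padicValInt p D'.c + 6 + padicValInt p W'.minimalDiscriminantInt =
            12 * padicValInt p D.c + padicValInt p W.minimalDiscriminantInt) ∨
      D'.modularDegree = D.modularDegree := by
  intro W W' _ _ _ _ _ _ D D' hD hD' hM hN hiso
  haveI : Fact p.Prime := ⟨hp⟩
  have hdZ : ((-1 : ℤ) ^ (p / 2) * p : ℤ) ≠ 0 :=
    mul_ne_zero (pow_ne_zero _ (by norm_num)) (by exact_mod_cast hp.ne_zero)
  have hcZ : D.c ≠ 0 := Int.cast_ne_zero.mp D.cast_c_ne_zero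
  have hcZ' : D'.c ≠ 0 := Int.cast_ne_zero.mp D'.cast_c_ne_zero
  have hΔm : W.minimalDiscriminantInt ≠ 0 := W.minimalDiscriminantInt_ne_zero
  have hΔm' : W'.minimalDiscriminantInt ≠ 0 := W'.minimalDiscriminantInt_ne_zero
  rcases pStar_optimal_orbit_trichotomy_full hp hp2 W W' D D' hD hD' hM hN hiso with
    ⟨-, hdeg, hΔ⟩ | ⟨-, hdeg, hΔ⟩ | hdeg
  · left
    refine ⟨hdeg, ?_⟩
    rw [← W.cast_minimalDiscriminantInt, ← W'.cast_minimalDiscriminantInt] at hΔ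
    have hZ : D'.c ^ 12 * W'.minimalDiscriminantInt =
        D.c ^ 12 * (((-1 : ℤ) ^ (p / 2) * p) ^ 6 * W.minimalDiscriminantInt) := by
      exact_mod_cast hΔ
    have hv := congrArg (padicValInt p) hZ
    rw [padicValInt.mul (pow_ne_zero _ hcZ') hΔm',
      padicValInt.mul (pow_ne_zero _ hcZ) (mul_ne_zero (pow_ne_zero _ hdZ) hΔm),
      padicValInt.mul (pow_ne_zero _ hdZ) hΔm, padicValInt_pow', padicValInt_pow', padicValInt_pow',
      padicValInt_pStar] at hv
    push_cast at hv
    omega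
  · right; left
    refine ⟨hdeg, ?_⟩
    rw [← W.cast_minimalDiscriminantInt, ← W'.cast_minimalDiscriminantInt] at hΔ
    have hZ : D'.c ^ 12 * (((-1 : ℤ) ^ (p / 2) * p) ^ 6 * W'.minimalDiscriminantInt) =
        D.c ^ 12 * W.minimalDiscriminantInt := by
      exact_mod_cast hΔ
    have hv := congrArg (padicValInt p) hZ
    rw [padicValInt.mul (pow_ne_zero _ hcZ') (mul_ne_zero (pow_ne_zero _ hdZ) hΔm'),
      padicValInt.mul (pow_ne_zero _ hdZ) hΔm', padicValInt.mul (pow_ne_zero _ hcZ) hΔm,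
      padicValInt_pow', padicValInt_pow', padicValInt_pow', padicValInt_pStar] at hv
    push_cast at hv
    omega
  · right; right
    exact hdeg
/-- E-imc-1b (isogeny form, all pairs) ⇒ its restriction to commuting pairs. -/
theorem commutingOrbitManinValEq_of_maninInvariance {p : ℕ} (hp : p.Prime) (hp2 : p ≠ 2)
    (hI : RamifiedTwistManinInvariance p) : CommutingOrbitManinValEq p := by
  intro W W' _ _ _ _ _ _ u D D' hD hD' hM hN hu
  exact hI W W' D D' hp hp2 hD hD' hM hN (isIsogenous_of_smul_eq hu)

/-- **E-imc-7R at odd `p` ⟸ orbit Manin `p`-invariance on COMMUTING pairs (PROVED EDGE).**  In the two rigid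
cases of the trichotomy the Manin-twisted identities `c′¹²Δ′ = c¹²(p*)⁶Δ` / `c′¹²(p*)⁶Δ′ = c¹²Δ` turn
`v_p(c′) = v_p(c)` into the discriminant coupling `v_pΔ′_min = v_pΔ_min ± 6`; the flip case is clause 3. -/
theorem ramifiedTwistDegreeTrichotomy_of_commutingManinValEq {p : ℕ} (hp2 : p ≠ 2)
    (hV : CommutingOrbitManinValEq p) (d : ℤ) : RamifiedTwistDegreeTrichotomy p d := by
  intro W W' _ _ _ _ _ _ D D' hp hd hD hD' hM hN hiso
  haveI : Fact p.Prime := ⟨hp⟩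
  rcases hd with hd | ⟨rfl, _⟩
  swap
  · exact absurd rfl hp2
  rw [hd] at hiso
  have hdZ : ((-1 : ℤ) ^ (p / 2) * p : ℤ) ≠ 0 :=
    mul_ne_zero (pow_ne_zero _ (by norm_num)) (by exact_mod_cast hp.ne_zero)
  have hcZ : D.c ≠ 0 := Int.cast_ne_zero.mp D.cast_c_ne_zero
  have hcZ' : D'.c ≠ 0 := Int.cast_ne_zero.mp D'.cast_c_ne_zero
  have hΔm : W.minimalDiscriminantInt ≠ 0 := W.minimalDiscriminantInt_ne_zero
  have hΔm' : W'.minimalDiscriminantInt ≠ 0 := W'.minimalDiscriminantInt_ne_zero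
  rcases pStar_optimal_orbit_trichotomy_full hp hp2 W W' D D' hD hD' hM hN hiso with
    ⟨⟨u, hu⟩, hdeg, hΔ⟩ | ⟨⟨u, hu⟩, hdeg, hΔ⟩ | hdeg
  · left
    refine ⟨hdeg, ?_⟩
    have hvc := hV W W' u D D' hD hD' hM hN hu
    rw [← W.cast_minimalDiscriminantInt, ← W'.cast_minimalDiscriminantInt] at hΔ
    have hZ : D'.c ^ 12 * W'.minimalDiscriminantInt =
        D.c ^ 12 * (((-1 : ℤ) ^ (p / 2) * p) ^ 6 * W.minimalDiscriminantInt) := by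
      exact_mod_cast hΔ
    have hv := congrArg (padicValInt p) hZ
    rw [padicValInt.mul (pow_ne_zero _ hcZ') hΔm',
      padicValInt.mul (pow_ne_zero _ hcZ) (mul_ne_zero (pow_ne_zero _ hdZ) hΔm),
      padicValInt.mul (pow_ne_zero _ hdZ) hΔm, padicValInt_pow', padicValInt_pow', padicValInt_pow',
      padicValInt_pStar, hvc] at hv
    push_cast at hv
    omega
  · right; left
    refine ⟨hdeg.symm, ?_⟩
    have hvc := hV W W' u D D' hD hD' hM hN hu
    rw [← W.cast_minimalDiscriminantInt, ← W'.cast_minimalDiscriminantInt] at hΔ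
    have hZ : D'.c ^ 12 * (((-1 : ℤ) ^ (p / 2) * p) ^ 6 * W'.minimalDiscriminantInt) =
        D.c ^ 12 * W.minimalDiscriminantInt := by
      exact_mod_cast hΔ
    have hv := congrArg (padicValInt p) hZ
    rw [padicValInt.mul (pow_ne_zero _ hcZ') (mul_ne_zero (pow_ne_zero _ hdZ) hΔm'),
      padicValInt.mul (pow_ne_zero _ hdZ) hΔm', padicValInt.mul (pow_ne_zero _ hcZ) hΔm,
      padicValInt_pow', padicValInt_pow', padicValInt_pow', padicValInt_pStar, hvc] at hv
    push_cast at hv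
    omega
  · right; right
    exact hdeg

/-- **E-imc-1b ⇒ E-imc-7R at odd `p` (PROVED EDGE between two imc leaves).** -/
theorem ramifiedTwistDegreeTrichotomy_of_maninInvariance {p : ℕ} (hp : p.Prime) (hp2 : p ≠ 2)
    (hI : RamifiedTwistManinInvariance p) (d : ℤ) : RamifiedTwistDegreeTrichotomy p d :=
  ramifiedTwistDegreeTrichotomy_of_commutingManinValEq hp2
    (commutingOrbitManinValEq_of_maninInvariance hp hp2 hI) d

/-- Instance at the cell's prime `p = 3`: E-imc-1b(3) ⇒ E-imc-7R(3, d) for every `d`. -/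
theorem ramifiedTwistDegreeTrichotomy_three_of_maninInvariance (hI : RamifiedTwistManinInvariance 3)
    (d : ℤ) : RamifiedTwistDegreeTrichotomy 3 d :=
  ramifiedTwistDegreeTrichotomy_of_maninInvariance (by norm_num) (by norm_num) hI d

/-- **Hypothesis-free packaging of the edge E-imc-1b ⇒ E-imc-7R at odd `p`.** -/
@[conjecture] def RamifiedTwistDegreeTrichotomyOfManinInvariance (p : ℕ) (d : ℤ) : Prop :=
  p.Prime → p ≠ 2 → RamifiedTwistManinInvariance p → RamifiedTwistDegreeTrichotomy p d

/-- `ramifiedTwistDegreeTrichotomyOfManinInvariance_holds`: the kernel-checked closer (hypothesis-free). -/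
theorem ramifiedTwistDegreeTrichotomyOfManinInvariance_holds (p : ℕ) (d : ℤ) :
    RamifiedTwistDegreeTrichotomyOfManinInvariance p d :=
  fun hp hp2 hI ↦ ramifiedTwistDegreeTrichotomy_of_maninInvariance hp hp2 hI d

end CovolumeEngine

end Summit.BirchSwinnertonDyer.Rank1Residual.ManinAdditive

end
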